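import Summits.BirchSwinnertonDyer.BirchSwinnertonDyer.Theorems.KolyvaginDepthDoorDepthTableRowKitOfPrint
import Summits.BirchSwinnertonDyer.BirchSwinnertonDyer.Theorems.KolyvaginDepthDoorDepthTableRows5
import Summits.BirchSwinnertonDyer.BirchSwinnertonDyer.Theorems.KolyvaginDepthDoorDepthTableRows6
import Summits.BirchSwinnertonDyer.BirchSwinnertonDyer.Theorems.KolyvaginDepthDoorDepthTableOddPrimeKit
import Summits.BirchSwinnertonDyer.BirchSwinnertonDyer.Theorems.Rank1ResidualIntModelReduction
import Literature.NumberTheory.EllipticCurves.ComplexMultiplicationNotSemistable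
import HarnessLib

/-!
# Route `KolyvaginDepthDoor` — DEPTH-TABLE rows WITHOUT Kolyvagin's structure theorem (5/5):
# `817a1` `(5, -8, 239)`, `997b1` `(5, -52, 199)`, `997c1` `(5, -67, 229)` (crux `KolyvaginDepthSupply`, stmt-BirchSwinnertonDyer-21765)

Helper file (`--supports stmt-BirchSwinnertonDyer-21765 --as helper`); it closes nothing and BSD is
not proved by it. Continuation of `…DepthTableRowsOfPrint1` (rows `389a1`, `709a1`, `718b1`): the
rows of `…DepthTableRows5/6` rewritten over the row kit WITHOUT `hF`
(`depthRow_of_print_of_intModel_certificate`, file `…DepthTableRowKitOfPrint`; engine: Kolyvagin's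
minimal-depth descent, `Literature…HeegnerPointsKolyvaginDepthDescent`, proved as algebra), with the
two extra kernel side conditions discharged per curve: `p ∈ B(E)` (the `p`-adic tower surjectivity,
`hasSurjectiveModNGaloisRep_pow_of_intModel_certificate`: semistability, an irreducibility witness,
and a multiplicative prime `ℓ₀ ∥ Δ`) and `¬ HasCM` (multiplicative reduction at `ℓ₀`).

Each row: for ANY imaginary quadratic `K` with the row's `d_K`, any frame and any COMPATIBLE system of
Kolyvagin–Heegner data, granted the five named leaves `sign_conjAct_kolyvaginClass` (Gross 5.4 (2)),
`lemma43_kolyvaginClass_mem_selmerLocalKer` (McCallum L4.3), `prop44_localOrder_kolyvaginClass_mul_eq`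
(P4.4), `lemma53_selmer_eigen_dependent_at` (L5.3), `prop22_reciprocity_eigen_finset` (P2.2+L5.3):
bit `c_1(ℓ) ≠ 0` + one rational point of infinite order on the twist ⟹ `corank_{ℤ_p} Ш(E)[p^∞] = 0`,
`rank E(ℚ) = 2`, `rank E^{(d_K)}(ℚ) = 1`. Honest trade versus the hF-rows: Kolyvagin Thm. 4 (XL) ↦
five S/M leaves + the SYSTEM of data + one twist point. The three additive curves of the table
(`664a1`, `916c1`, `944e1`) are not treated here (the tower certificate used is the semistable one).
Per-curve; BSD is not proved by it.
-/

set_option linter.dupNamespace false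

noncomputable section

open scoped Classical NumberField

namespace Summit.BirchSwinnertonDyer.BirchSwinnertonDyer.Theorems.KolyvaginDepthDoor

open Literature.NumberTheory.EllipticCurves Literature.NumberTheory.EllipticCurves.ModularForms
  Literature.NumberTheory.EllipticCurves.McCallum1991 WeierstrassCurve
open Summit.BirchSwinnertonDyer.BirchSwinnertonDyer.Rank2Observatory
open Summit.BirchSwinnertonDyer.BirchSwinnertonDyer.Rank1Residual

/-! ## Row `817a1` = `[0,1,1,1,6]` (`N = 817, |Δ| = 19²·43`): `(p, d_K, ℓ) = (5, -8, 239)` -/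

namespace C817a1

/-- **`5 ∈ B(817a1)`: `ρ̄_{E,5^m}` onto for every `m`** (semistable `gcd(c₄, Δ) = 1`;
`X² − a_3 X + 3`, `a_3 = -2`, root-free mod `5`: `E[5]` irreducible (Mazur 6.3), onto (Serre
Prop. 21); the multiplicative prime `43 ∥ Δ` with `5 ∤ 1` lifts the image to `GL₂(ℤ/5^m)`).
[cite: Serre1972, §5.4 Prop. 21] [cite: SerreAbelianLadic1968, Ch. IV §3.4] -/
theorem hasSurjectiveModNGaloisRep_pow_5 (m : ℕ) :
    ((⟨0, 1, 1, 1, 6⟩ : WeierstrassCurve ℤ).map (Int.castRingHom ℚ)).HasSurjectiveModNGaloisRep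
      (5 ^ m : ℕ) := by
  have hn : ∀ t : ZMod 5, t ^ 2 - (((3 : ℕ) : ℤ) + 1 - (6 : ℕ) : ℤ) * t + ((3 : ℕ) : ZMod 5) ≠ 0 := by
    decide +kernel
  haveI := Fact.mk (by norm_num : Nat.Prime 5)
  haveI := Fact.mk (by norm_num : Nat.Prime 3)
  haveI := isElliptic_c817a1
  haveI := isGloballyMinimal_c817a1
  exact hasSurjectiveModNGaloisRep_pow_of_intModel_certificate intModel
    (by rw [Int.isCoprime_iff_gcd_eq_one]; decide +kernel) 5 3 (by norm_num) (by decide +kernel)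
    (n := 6) card_3 hn 43 (by norm_num) (by norm_num) (by decide +kernel) (by decide +kernel)
    (e := 1) (by decide +kernel) (by decide +kernel) (by decide +kernel) m

/-- **`817a1` is not CM** (multiplicative reduction at `43`; a CM curve has integral `j`).
[cite: SilvermanATAEC1994, Thm. II.6.4 (PDF p. 148)] [cite: CremonaAlgorithms1997, Table 1 (817a1)] -/
theorem not_hasCM :
    haveI := isElliptic_c817a1;
    ¬ ((⟨0, 1, 1, 1, 6⟩ : WeierstrassCurve ℤ).map (Int.castRingHom ℚ)).HasCM := by
  haveI := isElliptic_c817a1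
  haveI := isGloballyMinimal_c817a1
  haveI := Fact.mk (by norm_num : Nat.Prime 43)
  intro hCM
  exact not_hasMultiplicativeReductionAtPrime_of_hasCM _ hCM 43
    (IntModel.hasMultiplicativeReductionAtPrime_of_intModel intModel 43 (by decide +kernel)
      (by decide +kernel))

/-- **DEPTH-TABLE ROW `817a1`, `(p, d_K, ℓ) = (5, -8, 239)`, WITHOUT Kolyvagin's structure theorem**:
for ANY imaginary quadratic `K` with `d_K = -8`, any frame `(Dt, β, ι)` and any COMPATIBLE system `d n`
of Kolyvagin–Heegner data, granted the five named McCallum/Gross leaves (Gross Prop. 5.4 (2);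
McCallum Lemma 4.3, Prop. 4.4, Lemma 5.3, Prop. 2.2): the bit `(d 239).kolyvaginClass _ 1 ≠ 0` and one
rational point of infinite order on `E^{(-8)}` give `corank_{ℤ_5} Ш(E)[5^∞] = 0`,
`rank_ℤ E(ℚ) = 2`, `rank_ℤ E^{(-8)}(ℚ) = 1`, `corank_{ℤ_5} Ш(E^{(-8)})[5^∞] = 0`; every
side condition (`5 ∈ B(E)`, non-CM, Heegner hypothesis, Kolyvagin prime, `2 ≤ rank`) is a kernel
theorem. Twin of `C817a1.depthRow_5_neg8_239` (file `…DepthTableRows5`, modulo `hF`).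
CONDITIONAL on the five facts, the bit, the twist point; per-curve; BSD is not proved by it.
[cite: Kolyvagin1991MathAnn, Thm. 2.3] [cite: McCallumLMS1991, §§2–5]
[cite: JetchevLauterStein2009, §3.6 (arXiv:0707.0032)] -/
theorem depthRow_5_neg8_239_of_print
    (h54 : sign_conjAct_kolyvaginClass) (h43 : lemma43_kolyvaginClass_mem_selmerLocalKer)
    (h44 : prop44_localOrder_kolyvaginClass_mul_eq) (h53 : lemma53_selmer_eigen_dependent_at)
    (h22 : prop22_reciprocity_eigen_finset)
    (K : Type) [Field K] [NumberField K] (hK : IsImaginaryQuadratic K)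
    (hD : NumberField.discr K = -8) :
    haveI := isElliptic_c817a1;
    haveI := isGloballyMinimal_c817a1;
    haveI : NeZero (((⟨0, 1, 1, 1, 6⟩ : WeierstrassCurve ℤ).map (Int.castRingHom ℚ)).conductorNorm ℤ) :=
      neZero_conductorNorm_of_isElliptic _;
    ∀ (Dt : ModularParametrizationData ((⟨0, 1, 1, 1, 6⟩ : WeierstrassCurve ℤ).map (Int.castRingHom ℚ))
        (((⟨0, 1, 1, 1, 6⟩ : WeierstrassCurve ℤ).map (Int.castRingHom ℚ)).conductorNorm ℤ)) (β : ℤ)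
      (ι : K →+* ℂ) (d : ∀ m : ℕ, KolyvaginHeegnerData Dt β ι m),
    (∀ (m l : ℕ), ∀ l' ∈ m.primeFactors, ∀ (x : ringClassField K ι m)
      (x' : ringClassField K ι (m * l)),
      (x : ℂ) = x' → (((d (m * l)).σ l' x' : ringClassField K ι (m * l)) : ℂ) = ((d m).σ l' x : ℂ)) →
    (∀ (m l : ℕ), ∀ s ∈ (d m).S, ∃ s' ∈ (d (m * l)).S, ∀ (x : ringClassField K ι m)
      (x' : ringClassField K ι (m * l)),
      (x : ℂ) = x' → ((s' x' : ringClassField K ι (m * l)) : ℂ) = (s x : ℂ)) →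
    (∀ (m l : ℕ), ∀ s' ∈ (d (m * l)).S, ∃ s ∈ (d m).S, ∀ (x : ringClassField K ι m)
      (x' : ringClassField K ι (m * l)),
      (x : ℂ) = x' → ((s' x' : ringClassField K ι (m * l)) : ℂ) = (s x : ℂ)) →
    (∀ (m l : ℕ) (x : ringClassField K ι m) (x' : ringClassField K ι (m * l)),
      (x : ℂ) = x' → (d (m * l)).emb x' = (d m).emb x) →
    (d 239).kolyvaginClass (p := 5) (by norm_num) 1 ≠ 0 →
    1 ≤ (((⟨0, 1, 1, 1, 6⟩ : WeierstrassCurve ℤ).map (Int.castRingHom ℚ)).quadraticTwist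
      ((-8 : ℤ) : ℚ)).mordellWeilRank →
    ((⟨0, 1, 1, 1, 6⟩ : WeierstrassCurve ℤ).map (Int.castRingHom ℚ)).shaCorank 5 = 0 ∧
      ((⟨0, 1, 1, 1, 6⟩ : WeierstrassCurve ℤ).map (Int.castRingHom ℚ)).mordellWeilRank = 2 ∧
      (((⟨0, 1, 1, 1, 6⟩ : WeierstrassCurve ℤ).map (Int.castRingHom ℚ)).quadraticTwist
        ((-8 : ℤ) : ℚ)).mordellWeilRank = 1 ∧
      (((⟨0, 1, 1, 1, 6⟩ : WeierstrassCurve ℤ).map (Int.castRingHom ℚ)).quadraticTwist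
        ((-8 : ℤ) : ℚ)).shaCorank 5 = 0 := by
  haveI := isElliptic_c817a1
  haveI := isGloballyMinimal_c817a1
  haveI : NeZero (((⟨0, 1, 1, 1, 6⟩ : WeierstrassCurve ℤ).map (Int.castRingHom ℚ)).conductorNorm ℤ) :=
    neZero_conductorNorm_of_isElliptic _
  intro Dt β ι d hσ hS₁ hS₂ hemb hne htw
  haveI := Fact.mk (by norm_num : Nat.Prime 5)
  exact depthRow_of_print_of_intModel_certificate intModel h54 h43 h44 h53 h22 not_hasCM
    KernelCertsR01.C817a1.two_le_rank 5 (by norm_num) hasSurjectiveModNGaloisRep_pow_5 K hK hD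
    (by norm_num) (by norm_num) heegner_neg8 239 (by norm_num) (by norm_num) (by decide +kernel)
    (by norm_num) (by norm_num) (by norm_num) (by norm_num) (n := 240) card_239 (by norm_num) Dt β ι
    d hσ hS₁ hS₂ hemb hne htw

end C817a1

/-! ## Row `997b1` = `[0,-1,1,-5,-3]` (`N = 997, |Δ| = 997`): `(p, d_K, ℓ) = (5, -52, 199)` -/

namespace C997b1

/-- **`5 ∈ B(997b1)`: `ρ̄_{E,5^m}` onto for every `m`** (semistable `gcd(c₄, Δ) = 1`;
`X² − a_13 X + 13`, `a_13 = -5`, root-free mod `5`: `E[5]` irreducible (Mazur 6.3), onto (Serre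
Prop. 21); the multiplicative prime `997 ∥ Δ` with `5 ∤ 1` lifts the image to `GL₂(ℤ/5^m)`).
[cite: Serre1972, §5.4 Prop. 21] [cite: SerreAbelianLadic1968, Ch. IV §3.4] -/
theorem hasSurjectiveModNGaloisRep_pow_5 (m : ℕ) :
    ((⟨0, -1, 1, -5, -3⟩ : WeierstrassCurve ℤ).map (Int.castRingHom ℚ)).HasSurjectiveModNGaloisRep
      (5 ^ m : ℕ) := by
  have hn : ∀ t : ZMod 5, t ^ 2 - (((13 : ℕ) : ℤ) + 1 - (19 : ℕ) : ℤ) * t + ((13 : ℕ) : ZMod 5) ≠ 0 := by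
    decide +kernel
  haveI := Fact.mk (by norm_num : Nat.Prime 5)
  haveI := Fact.mk (by norm_num : Nat.Prime 13)
  haveI := isElliptic_c997b1
  haveI := isGloballyMinimal_c997b1
  exact hasSurjectiveModNGaloisRep_pow_of_intModel_certificate intModel
    (by rw [Int.isCoprime_iff_gcd_eq_one]; decide +kernel) 5 13 (by norm_num) (by decide +kernel)
    (n := 19) card_13 hn 997 (by norm_num) (by norm_num) (by decide +kernel) (by decide +kernel)
    (e := 1) (by decide +kernel) (by decide +kernel) (by decide +kernel) m

/-- **`997b1` is not CM** (multiplicative reduction at `997`; a CM curve has integral `j`).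
[cite: SilvermanATAEC1994, Thm. II.6.4 (PDF p. 148)] [cite: CremonaAlgorithms1997, Table 1 (997b1)] -/
theorem not_hasCM :
    haveI := isElliptic_c997b1;
    ¬ ((⟨0, -1, 1, -5, -3⟩ : WeierstrassCurve ℤ).map (Int.castRingHom ℚ)).HasCM := by
  haveI := isElliptic_c997b1
  haveI := isGloballyMinimal_c997b1
  haveI := Fact.mk (by norm_num : Nat.Prime 997)
  intro hCM
  exact not_hasMultiplicativeReductionAtPrime_of_hasCM _ hCM 997
    (IntModel.hasMultiplicativeReductionAtPrime_of_intModel intModel 997 (by decide +kernel)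
      (by decide +kernel))

/-- **DEPTH-TABLE ROW `997b1`, `(p, d_K, ℓ) = (5, -52, 199)`, WITHOUT Kolyvagin's structure theorem**:
for ANY imaginary quadratic `K` with `d_K = -52`, any frame `(Dt, β, ι)` and any COMPATIBLE system `d n`
of Kolyvagin–Heegner data, granted the five named McCallum/Gross leaves (Gross Prop. 5.4 (2);
McCallum Lemma 4.3, Prop. 4.4, Lemma 5.3, Prop. 2.2): the bit `(d 199).kolyvaginClass _ 1 ≠ 0` and one
rational point of infinite order on `E^{(-52)}` give `corank_{ℤ_5} Ш(E)[5^∞] = 0`,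
`rank_ℤ E(ℚ) = 2`, `rank_ℤ E^{(-52)}(ℚ) = 1`, `corank_{ℤ_5} Ш(E^{(-52)})[5^∞] = 0`; every
side condition (`5 ∈ B(E)`, non-CM, Heegner hypothesis, Kolyvagin prime, `2 ≤ rank`) is a kernel
theorem. Twin of `C997b1.depthRow_5_neg52_199` (file `…DepthTableRows6`, modulo `hF`).
CONDITIONAL on the five facts, the bit, the twist point; per-curve; BSD is not proved by it.
[cite: Kolyvagin1991MathAnn, Thm. 2.3] [cite: McCallumLMS1991, §§2–5]
[cite: JetchevLauterStein2009, §3.6 (arXiv:0707.0032)] -/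
theorem depthRow_5_neg52_199_of_print
    (h54 : sign_conjAct_kolyvaginClass) (h43 : lemma43_kolyvaginClass_mem_selmerLocalKer)
    (h44 : prop44_localOrder_kolyvaginClass_mul_eq) (h53 : lemma53_selmer_eigen_dependent_at)
    (h22 : prop22_reciprocity_eigen_finset)
    (K : Type) [Field K] [NumberField K] (hK : IsImaginaryQuadratic K)
    (hD : NumberField.discr K = -52) :
    haveI := isElliptic_c997b1;
    haveI := isGloballyMinimal_c997b1;
    haveI : NeZero (((⟨0, -1, 1, -5, -3⟩ : WeierstrassCurve ℤ).map (Int.castRingHom ℚ)).conductorNorm ℤ) :=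
      neZero_conductorNorm_of_isElliptic _;
    ∀ (Dt : ModularParametrizationData ((⟨0, -1, 1, -5, -3⟩ : WeierstrassCurve ℤ).map (Int.castRingHom ℚ))
        (((⟨0, -1, 1, -5, -3⟩ : WeierstrassCurve ℤ).map (Int.castRingHom ℚ)).conductorNorm ℤ)) (β : ℤ)
      (ι : K →+* ℂ) (d : ∀ m : ℕ, KolyvaginHeegnerData Dt β ι m),
    (∀ (m l : ℕ), ∀ l' ∈ m.primeFactors, ∀ (x : ringClassField K ι m)
      (x' : ringClassField K ι (m * l)),
      (x : ℂ) = x' → (((d (m * l)).σ l' x' : ringClassField K ι (m * l)) : ℂ) = ((d m).σ l' x : ℂ)) →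
    (∀ (m l : ℕ), ∀ s ∈ (d m).S, ∃ s' ∈ (d (m * l)).S, ∀ (x : ringClassField K ι m)
      (x' : ringClassField K ι (m * l)),
      (x : ℂ) = x' → ((s' x' : ringClassField K ι (m * l)) : ℂ) = (s x : ℂ)) →
    (∀ (m l : ℕ), ∀ s' ∈ (d (m * l)).S, ∃ s ∈ (d m).S, ∀ (x : ringClassField K ι m)
      (x' : ringClassField K ι (m * l)),
      (x : ℂ) = x' → ((s' x' : ringClassField K ι (m * l)) : ℂ) = (s x : ℂ)) →
    (∀ (m l : ℕ) (x : ringClassField K ι m) (x' : ringClassField K ι (m * l)),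
      (x : ℂ) = x' → (d (m * l)).emb x' = (d m).emb x) →
    (d 199).kolyvaginClass (p := 5) (by norm_num) 1 ≠ 0 →
    1 ≤ (((⟨0, -1, 1, -5, -3⟩ : WeierstrassCurve ℤ).map (Int.castRingHom ℚ)).quadraticTwist
      ((-52 : ℤ) : ℚ)).mordellWeilRank →
    ((⟨0, -1, 1, -5, -3⟩ : WeierstrassCurve ℤ).map (Int.castRingHom ℚ)).shaCorank 5 = 0 ∧
      ((⟨0, -1, 1, -5, -3⟩ : WeierstrassCurve ℤ).map (Int.castRingHom ℚ)).mordellWeilRank = 2 ∧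
      (((⟨0, -1, 1, -5, -3⟩ : WeierstrassCurve ℤ).map (Int.castRingHom ℚ)).quadraticTwist
        ((-52 : ℤ) : ℚ)).mordellWeilRank = 1 ∧
      (((⟨0, -1, 1, -5, -3⟩ : WeierstrassCurve ℤ).map (Int.castRingHom ℚ)).quadraticTwist
        ((-52 : ℤ) : ℚ)).shaCorank 5 = 0 := by
  haveI := isElliptic_c997b1
  haveI := isGloballyMinimal_c997b1
  haveI : NeZero (((⟨0, -1, 1, -5, -3⟩ : WeierstrassCurve ℤ).map (Int.castRingHom ℚ)).conductorNorm ℤ) :=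
    neZero_conductorNorm_of_isElliptic _
  intro Dt β ι d hσ hS₁ hS₂ hemb hne htw
  haveI := Fact.mk (by norm_num : Nat.Prime 5)
  exact depthRow_of_print_of_intModel_certificate intModel h54 h43 h44 h53 h22 not_hasCM
    KernelCertsR01.C997b1.two_le_rank 5 (by norm_num) hasSurjectiveModNGaloisRep_pow_5 K hK hD
    (by norm_num) (by norm_num) heegner_neg52 199 (by norm_num) (by norm_num) (by decide +kernel)
    (by norm_num) (by norm_num) (by norm_num) (by norm_num) (n := 205) card_199 (by norm_num) Dt β ι
    d hσ hS₁ hS₂ hemb hne htw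

end C997b1

/-! ## Row `997c1` = `[0,-1,1,-24,54]` (`N = 997, |Δ| = 997`): `(p, d_K, ℓ) = (5, -67, 229)` -/

namespace C997c1

/-- **`5 ∈ B(997c1)`: `ρ̄_{E,5^m}` onto for every `m`** (semistable `gcd(c₄, Δ) = 1`;
`X² − a_7 X + 7`, `a_7 = -4`, root-free mod `5`: `E[5]` irreducible (Mazur 6.3), onto (Serre
Prop. 21); the multiplicative prime `997 ∥ Δ` with `5 ∤ 1` lifts the image to `GL₂(ℤ/5^m)`).
[cite: Serre1972, §5.4 Prop. 21] [cite: SerreAbelianLadic1968, Ch. IV §3.4] -/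
theorem hasSurjectiveModNGaloisRep_pow_5 (m : ℕ) :
    ((⟨0, -1, 1, -24, 54⟩ : WeierstrassCurve ℤ).map (Int.castRingHom ℚ)).HasSurjectiveModNGaloisRep
      (5 ^ m : ℕ) := by
  have hn : ∀ t : ZMod 5, t ^ 2 - (((7 : ℕ) : ℤ) + 1 - (12 : ℕ) : ℤ) * t + ((7 : ℕ) : ZMod 5) ≠ 0 := by
    decide +kernel
  haveI := Fact.mk (by norm_num : Nat.Prime 5)
  haveI := Fact.mk (by norm_num : Nat.Prime 7)
  haveI := isElliptic_c997c1
  haveI := isGloballyMinimal_c997c1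
  exact hasSurjectiveModNGaloisRep_pow_of_intModel_certificate intModel
    (by rw [Int.isCoprime_iff_gcd_eq_one]; decide +kernel) 5 7 (by norm_num) (by decide +kernel)
    (n := 12) card_7 hn 997 (by norm_num) (by norm_num) (by decide +kernel) (by decide +kernel)
    (e := 1) (by decide +kernel) (by decide +kernel) (by decide +kernel) m

/-- **`997c1` is not CM** (multiplicative reduction at `997`; a CM curve has integral `j`).
[cite: SilvermanATAEC1994, Thm. II.6.4 (PDF p. 148)] [cite: CremonaAlgorithms1997, Table 1 (997c1)] -/
theorem not_hasCM :
    haveI := isElliptic_c997c1;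
    ¬ ((⟨0, -1, 1, -24, 54⟩ : WeierstrassCurve ℤ).map (Int.castRingHom ℚ)).HasCM := by
  haveI := isElliptic_c997c1
  haveI := isGloballyMinimal_c997c1
  haveI := Fact.mk (by norm_num : Nat.Prime 997)
  intro hCM
  exact not_hasMultiplicativeReductionAtPrime_of_hasCM _ hCM 997
    (IntModel.hasMultiplicativeReductionAtPrime_of_intModel intModel 997 (by decide +kernel)
      (by decide +kernel))

/-- **DEPTH-TABLE ROW `997c1`, `(p, d_K, ℓ) = (5, -67, 229)`, WITHOUT Kolyvagin's structure theorem**: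
for ANY imaginary quadratic `K` with `d_K = -67`, any frame `(Dt, β, ι)` and any COMPATIBLE system `d n`
of Kolyvagin–Heegner data, granted the five named McCallum/Gross leaves (Gross Prop. 5.4 (2);
McCallum Lemma 4.3, Prop. 4.4, Lemma 5.3, Prop. 2.2): the bit `(d 229).kolyvaginClass _ 1 ≠ 0` and one
rational point of infinite order on `E^{(-67)}` give `corank_{ℤ_5} Ш(E)[5^∞] = 0`,
`rank_ℤ E(ℚ) = 2`, `rank_ℤ E^{(-67)}(ℚ) = 1`, `corank_{ℤ_5} Ш(E^{(-67)})[5^∞] = 0`; every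
side condition (`5 ∈ B(E)`, non-CM, Heegner hypothesis, Kolyvagin prime, `2 ≤ rank`) is a kernel
theorem. Twin of `C997c1.depthRow_5_neg67_229` (file `…DepthTableRows6`, modulo `hF`).
CONDITIONAL on the five facts, the bit, the twist point; per-curve; BSD is not proved by it.
[cite: Kolyvagin1991MathAnn, Thm. 2.3] [cite: McCallumLMS1991, §§2–5]
[cite: JetchevLauterStein2009, §3.6 (arXiv:0707.0032)] -/
theorem depthRow_5_neg67_229_of_print
    (h54 : sign_conjAct_kolyvaginClass) (h43 : lemma43_kolyvaginClass_mem_selmerLocalKer)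
    (h44 : prop44_localOrder_kolyvaginClass_mul_eq) (h53 : lemma53_selmer_eigen_dependent_at)
    (h22 : prop22_reciprocity_eigen_finset)
    (K : Type) [Field K] [NumberField K] (hK : IsImaginaryQuadratic K)
    (hD : NumberField.discr K = -67) :
    haveI := isElliptic_c997c1;
    haveI := isGloballyMinimal_c997c1;
    haveI : NeZero (((⟨0, -1, 1, -24, 54⟩ : WeierstrassCurve ℤ).map (Int.castRingHom ℚ)).conductorNorm ℤ) :=
      neZero_conductorNorm_of_isElliptic _;
    ∀ (Dt : ModularParametrizationData ((⟨0, -1, 1, -24, 54⟩ : WeierstrassCurve ℤ).map (Int.castRingHom ℚ))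
        (((⟨0, -1, 1, -24, 54⟩ : WeierstrassCurve ℤ).map (Int.castRingHom ℚ)).conductorNorm ℤ)) (β : ℤ)
      (ι : K →+* ℂ) (d : ∀ m : ℕ, KolyvaginHeegnerData Dt β ι m),
    (∀ (m l : ℕ), ∀ l' ∈ m.primeFactors, ∀ (x : ringClassField K ι m)
      (x' : ringClassField K ι (m * l)),
      (x : ℂ) = x' → (((d (m * l)).σ l' x' : ringClassField K ι (m * l)) : ℂ) = ((d m).σ l' x : ℂ)) →
    (∀ (m l : ℕ), ∀ s ∈ (d m).S, ∃ s' ∈ (d (m * l)).S, ∀ (x : ringClassField K ι m)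
      (x' : ringClassField K ι (m * l)),
      (x : ℂ) = x' → ((s' x' : ringClassField K ι (m * l)) : ℂ) = (s x : ℂ)) →
    (∀ (m l : ℕ), ∀ s' ∈ (d (m * l)).S, ∃ s ∈ (d m).S, ∀ (x : ringClassField K ι m)
      (x' : ringClassField K ι (m * l)),
      (x : ℂ) = x' → ((s' x' : ringClassField K ι (m * l)) : ℂ) = (s x : ℂ)) →
    (∀ (m l : ℕ) (x : ringClassField K ι m) (x' : ringClassField K ι (m * l)),
      (x : ℂ) = x' → (d (m * l)).emb x' = (d m).emb x) →
    (d 229).kolyvaginClass (p := 5) (by norm_num) 1 ≠ 0 →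
    1 ≤ (((⟨0, -1, 1, -24, 54⟩ : WeierstrassCurve ℤ).map (Int.castRingHom ℚ)).quadraticTwist
      ((-67 : ℤ) : ℚ)).mordellWeilRank →
    ((⟨0, -1, 1, -24, 54⟩ : WeierstrassCurve ℤ).map (Int.castRingHom ℚ)).shaCorank 5 = 0 ∧
      ((⟨0, -1, 1, -24, 54⟩ : WeierstrassCurve ℤ).map (Int.castRingHom ℚ)).mordellWeilRank = 2 ∧
      (((⟨0, -1, 1, -24, 54⟩ : WeierstrassCurve ℤ).map (Int.castRingHom ℚ)).quadraticTwist
        ((-67 : ℤ) : ℚ)).mordellWeilRank = 1 ∧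
      (((⟨0, -1, 1, -24, 54⟩ : WeierstrassCurve ℤ).map (Int.castRingHom ℚ)).quadraticTwist
        ((-67 : ℤ) : ℚ)).shaCorank 5 = 0 := by
  haveI := isElliptic_c997c1
  haveI := isGloballyMinimal_c997c1
  haveI : NeZero (((⟨0, -1, 1, -24, 54⟩ : WeierstrassCurve ℤ).map (Int.castRingHom ℚ)).conductorNorm ℤ) :=
    neZero_conductorNorm_of_isElliptic _
  intro Dt β ι d hσ hS₁ hS₂ hemb hne htw
  haveI := Fact.mk (by norm_num : Nat.Prime 5)
  exact depthRow_of_print_of_intModel_certificate intModel h54 h43 h44 h53 h22 not_hasCM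
    KernelCerts003.C997c1.two_le_rank 5 (by norm_num) hasSurjectiveModNGaloisRep_pow_5 K hK hD
    (by norm_num) (by norm_num) heegner_neg67 229 (by norm_num) (by norm_num) (by decide +kernel)
    (by norm_num) (by norm_num) (by norm_num) (by norm_num) (n := 255) card_229 (by norm_num) Dt β ι
    d hσ hS₁ hS₂ hemb hne htw

end C997c1

end Summit.BirchSwinnertonDyer.BirchSwinnertonDyer.Theorems.KolyvaginDepthDoor

end
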